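import Summits.ABC.IUTFork.Repair.RHSigmaLicenceSigned
import HarnessLib

/-!
# R-H ROUND 2 (generic): the TOLERANCE form of the cell-slack minorant door — «cellwise minorant `L ≤ slack` with `PN Σᶠ L ≥ −ε` ⟹ Cor. 3.12 up to `ε`»

abc-iut cell, rung LADDER-ABC:A2.RESCUE.H, R-H ROUND 2 seat abc-iut-rh2-q2-eq (gen 2). PROOF-ONLY, 20-line sequel of `RHSigmaLicenceSigned.lean` (p479556:
`StatementUpTo P ε ⟺ PN Σᶠ cellDeficit ≤ ε`). It is the `ε`-socket «(β_ε)» the generation pass asked for (abc-iut-rh3-gen-2 00:57:13Z: «a 15-line TOLERANCE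
variant of `RH.ReachLedgerBookkeeping.statement_of_minorant_total_nonneg` (:64) — `−ε ≤ Σ L ⟹ StatementUpTo ε`»): abc-iut-rh-typ-10's doors
`statement_of_minorant_total_nonneg` / abc-iut-rp-s2's `RHReachLedgerBudget.statement_of_cellSlack_minorant` conclude the PRINTED Statement from a cellwise
minorant of NON-NEGATIVE total; here the total may be `≥ −ε` and the conclusion is the weakened Corollary `StatementUpTo P ε` of `RHSigmaLicence.lean` (p468453).
The COMPOSITION (which minorant `L := c·marg·[j ≤ J⋆] − T·[j > J⋆]`, which `ε = (1 − μ_{J⋆})·M`) is the row-27 / generation-pass pen's, not this file's.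

* `statementUpTo_of_slack_minorant` — bridge hypotheses; `L i v_ℚ ≤ logvol(ⁿ˚𝒰_{i+1,v_ℚ}) − qLocal_{i+1,v_ℚ}` at every cell, `L i` finitely supported per
  label, `−ε ≤ PN(i ↦ Σᶠ_{v_ℚ} L i v_ℚ)` ⟹ `StatementUpTo P ε`.
* `statementUpTo_of_slack_minorant_on` — the same with `L` given on a finite set `W i` of places per label and slack `≥ 0` demanded off `W`.
* `statement_of_slack_minorant'` — `ε = 0` recovers the printed Statement (abc-iut-rp-s2's door, over the bridge hypotheses).
HONEST FRAMING: an implication about OUR typed objects; the minorant and its total are ASSUMPTION SHAPES, never asserted at any datum; nothing here asserts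
that abc is proved or refuted or takes a side on [IUTchIII] Cor. 3.12 or on any author; typed ≠ proved. [claim: Mochizuki2012, status: disputed]
[cite: Mochizuki2012, IUTchIII Cor. 3.12 p. 173–174, Prop. 3.9 (i)(iii) p. 116]
-/

noncomputable section

open Set Function

namespace Summit.ABC.IUTFork.Repair.RH.SigmaLicence

open Summit.ABC.IUTFork.Thm311 Summit.ABC.IUTFork.Cor312 Summit.ABC.IUTFork.Cor312.Setting Summit.ABC.IUTFork.Cor312Vol
  Literature.IUT.LogThetaLattice

variable {T : ThetaIndex} {S : Situation T} {P : Cor312.Setting S}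

/-- **(β_ε) THE TOLERANCE MINORANT DOOR.** Under the bridge hypotheses: a cellwise minorant `L ≤ slack = logvol(ⁿ˚𝒰) − qLocal`, finitely supported per label,
whose procession-normalised total is `≥ −ε`, gives Cor. 3.12 weakened by `ε`. (`ε = 0`: abc-iut-rp-s2 / abc-iut-rh-typ-10's printed-Statement doors.)
[claim: Mochizuki2012, status: disputed] -/
theorem statementUpTo_of_slack_minorant (H : BridgeHyps P) (L : Fin T.lstar → T.VQ → ℝ)
    (hsupp : ∀ i : Fin T.lstar, (Function.support (L i)).Finite)
    (hL : ∀ (i : Fin T.lstar) (vQ : T.VQ),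
      L i vQ ≤ (S.D P.n).logvol (labelSucc i) vQ (P.thetaHull (labelSucc i) vQ) - P.qLocal (labelSucc i) vQ)
    {ε : ℝ} (hsum : -ε ≤ processionNormalized fun i : Fin T.lstar => ∑ᶠ vQ : T.VQ, L i vQ) :
    StatementUpTo P ε := by
  rw [statementUpTo_iff_avg_cellDeficit_le H]
  -- cellwise: `cellDeficit = −slack ≤ −L`
  have hle : processionNormalized (fun i : Fin T.lstar => ∑ᶠ vQ : T.VQ, cellDeficit P i vQ) ≤
      processionNormalized fun i : Fin T.lstar => ∑ᶠ vQ : T.VQ, -L i vQ := by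
    unfold processionNormalized
    refine div_le_div_of_nonneg_right (Finset.sum_le_sum fun i _ => ?_) (Nat.cast_nonneg _)
    refine finsum_le_finsum' (cellDeficit_support_finite H i) ((hsupp i).subset fun vQ hv => ?_) fun vQ => ?_
    · rw [Function.mem_support] at hv ⊢
      exact fun h0 => hv (by rw [h0, neg_zero])
    · have h := hL i vQ
      unfold cellDeficit
      linarith
  have hneg : (processionNormalized fun i : Fin T.lstar => ∑ᶠ vQ : T.VQ, -L i vQ) =
      -processionNormalized fun i : Fin T.lstar => ∑ᶠ vQ : T.VQ, L i vQ := by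
    unfold processionNormalized
    rw [← neg_div, ← Finset.sum_neg_distrib]
    congr 1
    exact Finset.sum_congr rfl fun i _ => finsum_neg_distrib (L i)
  rw [hneg] at hle
  linarith

/-- **(β_ε) on a finite set of cells**: the minorant given only on a finite set `W i` of rational places per label (slack `≥ 0` demanded off `W`, e.g. the
volume licence at good / archimedean packets), the budget a finite sum `≥ −ε`. [claim: Mochizuki2012, status: disputed] -/
theorem statementUpTo_of_slack_minorant_on (H : BridgeHyps P) (W : Fin T.lstar → Finset T.VQ) (L : Fin T.lstar → T.VQ → ℝ)
    (hL : ∀ (i : Fin T.lstar) (vQ : T.VQ), vQ ∈ W i →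
      L i vQ ≤ (S.D P.n).logvol (labelSucc i) vQ (P.thetaHull (labelSucc i) vQ) - P.qLocal (labelSucc i) vQ)
    (hoff : ∀ (i : Fin T.lstar) (vQ : T.VQ), vQ ∉ W i →
      0 ≤ (S.D P.n).logvol (labelSucc i) vQ (P.thetaHull (labelSucc i) vQ) - P.qLocal (labelSucc i) vQ)
    {ε : ℝ} (hsum : -ε ≤ processionNormalized fun i : Fin T.lstar => ∑ vQ ∈ W i, L i vQ) :
    StatementUpTo P ε := by
  classical
  refine statementUpTo_of_slack_minorant H (fun i vQ => if vQ ∈ W i then L i vQ else 0) (fun i => ?_) (fun i vQ => ?_) ?_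
  · exact (W i).finite_toSet.subset fun vQ hvQ => by
      by_contra h
      exact hvQ (if_neg h)
  · by_cases h : vQ ∈ W i
    · rw [if_pos h]; exact hL i vQ h
    · rw [if_neg h]; exact hoff i vQ h
  · refine hsum.trans_eq (congrArg processionNormalized (funext fun i => ?_))
    rw [finsum_eq_sum_of_support_subset _ (s := W i)]
    · exact Finset.sum_congr rfl fun vQ hv => (if_pos hv).symm
    · intro vQ hv
      by_contra h
      exact hv (if_neg h)

/-- `ε = 0`: a cellwise minorant of non-negative total gives the PRINTED Statement (abc-iut-rp-s2's `statement_of_cellSlack_minorant`, here over the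
bridge hypotheses). [claim: Mochizuki2012, status: disputed] -/
theorem statement_of_slack_minorant' (H : BridgeHyps P) (L : Fin T.lstar → T.VQ → ℝ)
    (hsupp : ∀ i : Fin T.lstar, (Function.support (L i)).Finite)
    (hL : ∀ (i : Fin T.lstar) (vQ : T.VQ),
      L i vQ ≤ (S.D P.n).logvol (labelSucc i) vQ (P.thetaHull (labelSucc i) vQ) - P.qLocal (labelSucc i) vQ)
    (hsum : 0 ≤ processionNormalized fun i : Fin T.lstar => ∑ᶠ vQ : T.VQ, L i vQ) : P.Statement :=
  statementUpTo_zero_iff.mp (statementUpTo_of_slack_minorant H L hsupp hL (ε := 0) (by rwa [neg_zero]))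

/-- Budget bookkeeping: a minorant total `≥ −ε` and a further tolerance `ε ≤ ε'` give `StatementUpTo P ε'`. [folklore] -/
theorem statementUpTo_of_slack_minorant_of_le (H : BridgeHyps P) (L : Fin T.lstar → T.VQ → ℝ)
    (hsupp : ∀ i : Fin T.lstar, (Function.support (L i)).Finite)
    (hL : ∀ (i : Fin T.lstar) (vQ : T.VQ),
      L i vQ ≤ (S.D P.n).logvol (labelSucc i) vQ (P.thetaHull (labelSucc i) vQ) - P.qLocal (labelSucc i) vQ)
    {ε ε' : ℝ} (hsum : -ε ≤ processionNormalized fun i : Fin T.lstar => ∑ᶠ vQ : T.VQ, L i vQ) (hε : ε ≤ ε') :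
    StatementUpTo P ε' :=
  statementUpTo_mono hε (statementUpTo_of_slack_minorant H L hsupp hL hsum)

end Summit.ABC.IUTFork.Repair.RH.SigmaLicence

end
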